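import Summits.BirchSwinnertonDyer.BirchSwinnertonDyer.Theorems.ManinLocalTwoThreeStevensCuspInvGaloisAction
import Summits.BirchSwinnertonDyer.BirchSwinnertonDyer.Theorems.ManinLocalTwoThreeNaturalTes75Consumers
import HarnessLib

/-!
# T-es-75♮ (Stevens 1982 Thm 1.3.1 (b) WITHOUT optimality) holds; the rung modulo {modularity, CDT}
(route `ManinLocalTwoThree`; rung target stmt-BirchSwinnertonDyer-22445, crux C2 stmt-BirchSwinnertonDyer-22967; cell bsd-f2-manin, LEAD prover p1
gen 22)

The proof of `StevensGalois.optimalGamma1Parametrization_cuspInv_galoisAction_holds` (`…StevensCuspInvGaloisAction`, p766724) never uses the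
hypothesis `D.IsOptimal`; this file records the hypothesis-free form — verbatim the binder `hSt` ("T-es-75♮") of p2 gen 23's
`…NaturalTes75Consumers` — and plugs it into that file's rows, so that every consequence listed there holds modulo the named facts that remain:

* `naturalTes75_holds` — T-es-75♮: for every elliptic `W/ℚ`, every `X₁(N)`-datum `D`, every `σ ∈ Aut_ℚ(ℂ)` with `σ(e^{2πi/N}) = e^{2πid/N}`,
  `dd′ ≡ 1 (N)`, and every `y ≠ 0`: `σ(u(c·{∞,1/y})) = u(c·{∞,1/(d′y)})`;
* `shimuraKernelCyclic_of_modularity : exists_isNewformOf → ShimuraCyclic.ShimuraKernelCyclic`, `gamma1PeriodsNotInsideTwice_of_modularity`;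
* `abbesUllmo_and_cesnavicius_of_CDT : CDT → abbesUllmo_not_dvd_maninConstant_of_not_dvd_level ∧ cesnavicius_not_two_dvd_maninConstant_of_two_dvd_level`;
* `maninLocalTwoThree_maninConstantOne_of_CDT_of_modularity : CDT → exists_isNewformOf → ManinConstantOne` and the rung BY NAME
  `maninLocalTwoThree_maninConstantOneRung_of_CDT_of_modularity : CDT → exists_isNewformOf → ManinConstantOneRung`.

HONEST FRAMING.  `naturalTes75_holds` is an unconditional theorem.  Everything else is CONDITIONAL on named facts WITHOUT `_holds` in the tree —
the Modularity Theorem `exists_isNewformOf` (Diamond–Shurman Thm 8.8.3) and/or the unbounded-denominators theorem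
`CalegariDimitrovTang2025_unboundedDenominators` (CDT Thm 1) — taken as hypotheses; the trust base of the rung row is exactly {those two typed
statements, the tree's definitions `ModularParametrizationData` / `maninConstant` / `periodLattice` / `Gamma1ParametrizationData`}.  Manin's conjecture is
NOT proved unconditionally; the rung item and C2 stay OPEN as filed; BSD is NOT proved by this.
[cite: Stevens1982, §1.3 Thm. 1.3.1 (b)] [cite: CalegariDimitrovTang2025, Thm. 1] [cite: DiamondShurman2005, Thm. 8.8.3] [cite: Manin1972, §1.6]
-/

-- lint-debt: the directory name repeats the summit name (sibling precedent `ManinLocalTwoThreeStevensCuspInvGaloisAction.lean`)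
set_option linter.dupNamespace false
set_option autoImplicit false

noncomputable section

open Complex Filter Topology Set Function
open UpperHalfPlane hiding I
open scoped Real Topology MatrixGroups PeriodPair ModularForm
open ModularForm CongruenceSubgroup
open Literature.NumberTheory.EllipticCurves Literature.NumberTheory.EllipticCurves.ModularForms
open Literature.NumberTheory.Automorphic

namespace Summit.BirchSwinnertonDyer.BirchSwinnertonDyer.Theorems.ManinLocalTwoThree.StevensGalois

variable {N : ℕ} [NeZero N]

/-! ## §1 T-es-75♮ -/

/-- The cusp symbol of the parabolic-type matrix `(1,0;y,1)` is `{∞, 1/y}` and lies in `Λ₁(f)` as soon as it lies in `Γ₁(N)`;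
used in the degenerate level `N = 1` (copy of the private lemma of `…StevensCuspInvGaloisAction`). [cite: Stevens1989, §2] -/
private theorem modularSymbol_mem_of_gamma1' {W : WeierstrassCurve ℚ} (D₁ : Gamma1ParametrizationData W N) (hc : (D₁.c : ℂ) ≠ 0)
    (γ : SL(2, ℤ)) (hγ : γ ∈ Gamma1 N) (hγ10 : (γ 1 0 : ℤ) ≠ 0) :
    modularSymbol D₁.f (((γ 0 0 : ℤ) : ℚ) / ((γ 1 0 : ℤ) : ℚ)) ∈ (D₁.L.mulLeft ((D₁.c : ℂ)⁻¹) (inv_ne_zero hc)).lattice := by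
  have h := cuspSymbol_mem_L₁ D₁ hc ⟨γ, Gamma1_in_Gamma0 N hγ⟩ hγ
  unfold cuspSymbol at h
  simp only [hγ10, if_false] at h
  exact h

omit [NeZero N] in
/-- **T-es-75♮ — Stevens 1982, Thm. 1.3.1 (b) for EVERY `X₁(N)`-datum (no optimality)**, verbatim the binder `hSt` of `…NaturalTes75Consumers`:
for `σ ∈ Aut_ℚ(ℂ)` with `σ(e^{2πi/N}) = e^{2πid/N}`, `dd′ ≡ 1 (N)`, the value of the parametrisation at the cusp `1/y` is mapped by `σ` to the
value at the cusp `1/(d′y)`.  Same proof as `optimalGamma1Parametrization_cuspInv_galoisAction_holds` (which never used `IsOptimal`).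
[cite: Stevens1982, §1.3 Thm. 1.3.1 (b)] [cite: ShimuraIATAF1971, §6.2] -/
theorem naturalTes75_holds : ∀ (W : WeierstrassCurve ℚ) [W.IsElliptic] {N : ℕ} [NeZero N] (D : Gamma1ParametrizationData W N)
    (σ : ℂ ≃ₐ[ℚ] ℂ) (d d' : ℤ), ((d * d' : ℤ) : ZMod N) = 1 →
    σ (Complex.exp (2 * Real.pi * Complex.I / N)) = Complex.exp (2 * Real.pi * Complex.I * d / N) →
    ∀ y : ℤ, y ≠ 0 →
      WeierstrassCurve.Affine.Point.map (W' := W) (σ : ℂ →ₐ[ℚ] ℂ) (D.uniformize ((D.c : ℂ) * modularSymbol D.f (1 / y))) =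
        D.uniformize ((D.c : ℂ) * modularSymbol D.f (1 / (d' * y))) := by
  intro W _ N _ D₁ σ d d' hdd hσ y hy
  classical
  have hc0 : D₁.c ≠ 0 := D₁.maninConstant_ne_zero
  have hc : (D₁.c : ℂ) ≠ 0 := by exact_mod_cast hc0
  set L₁ := D₁.L.mulLeft ((D₁.c : ℂ)⁻¹) (inv_ne_zero hc) with hL₁
  set σ' : ℂ →+* ℂ := (σ : ℂ →+* ℂ) with hσ'def
  have hσ' : σ' (cexp (2 * π * Complex.I / N)) = cexp (2 * π * Complex.I * d / N) := hσ
  -- membership in `Λ_W` versus `L₁`, and the uniformisation on / off the lattice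
  have hmemL : ∀ w : ℂ, w ∈ L₁.lattice ↔ (D₁.c : ℂ) * w ∈ D₁.L.lattice := fun w ↦ by
    rw [hL₁, PeriodPair.mem_mulLeft_lattice, inv_inv]
  have hker : ∀ w : ℂ, D₁.uniformize w = 0 ↔ w ∈ D₁.L.lattice := fun w ↦ by
    rw [← SetLike.mem_coe, ← D₁.ker_uniformize, SetLike.mem_coe, AddMonoidHom.mem_ker]
  have hwp : ∀ w : ℂ, ℘[D₁.L] ((D₁.c : ℂ) * w) = ((D₁.c : ℂ) ^ 2)⁻¹ * ℘[L₁] w := fun w ↦ by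
    have h := PeriodPair.weierstrassP_mulLeft ((D₁.c : ℂ)⁻¹) (inv_ne_zero hc) D₁.L ((D₁.c : ℂ) * w)
    rw [← mul_assoc, inv_mul_cancel₀ hc, one_mul, inv_pow, inv_inv] at h
    rw [← hL₁] at h
    rw [h, ← mul_assoc, inv_mul_cancel₀ (pow_ne_zero 2 hc), one_mul]
  have hwp' : ∀ w : ℂ, ℘'[D₁.L] ((D₁.c : ℂ) * w) = ((D₁.c : ℂ) ^ 3)⁻¹ * ℘'[L₁] w := fun w ↦ by
    have h := PeriodPair.derivWeierstrassP_mulLeft ((D₁.c : ℂ)⁻¹) (inv_ne_zero hc) D₁.L ((D₁.c : ℂ) * w)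
    rw [← mul_assoc, inv_mul_cancel₀ hc, one_mul, inv_pow, inv_inv] at h
    rw [← hL₁] at h
    rw [h, ← mul_assoc, inv_mul_cancel₀ (pow_ne_zero 3 hc), one_mul]
  -- `σ` fixes the (rational) coefficients of the model and `c`
  have hσb₂ : σ' (W.baseChange ℂ).b₂ = (W.baseChange ℂ).b₂ := by
    rw [show (W.baseChange ℂ).b₂ = ((W.b₂ : ℚ) : ℂ) by simp [WeierstrassCurve.baseChange, WeierstrassCurve.map_b₂], map_ratCast]
  have hσa₁ : σ' (W.baseChange ℂ).a₁ = (W.baseChange ℂ).a₁ := by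
    rw [show (W.baseChange ℂ).a₁ = ((W.a₁ : ℚ) : ℂ) by simp [WeierstrassCurve.baseChange], map_ratCast]
  have hσa₃ : σ' (W.baseChange ℂ).a₃ = (W.baseChange ℂ).a₃ := by
    rw [show (W.baseChange ℂ).a₃ = ((W.a₃ : ℚ) : ℂ) by simp [WeierstrassCurve.baseChange], map_ratCast]
  have hσc : σ' (D₁.c : ℂ) = (D₁.c : ℂ) := map_intCast σ' _
  -- the conclusion for two cusps `1/y`, `1/y'` from the alternative of `transport_cusp_values`
  have key : ∀ {z z' : ℂ}, ((z ∈ L₁.lattice ∧ z' ∈ L₁.lattice) ∨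
      (z ∉ L₁.lattice ∧ z' ∉ L₁.lattice ∧ ℘[L₁] z' = σ' (℘[L₁] z) ∧ ℘'[L₁] z' = σ' (℘'[L₁] z))) →
      WeierstrassCurve.Affine.Point.map (W' := W) (σ : ℂ →ₐ[ℚ] ℂ) (D₁.uniformize ((D₁.c : ℂ) * z)) =
        D₁.uniformize ((D₁.c : ℂ) * z') := by
    rintro z z' (⟨hz, hz'⟩ | ⟨hz, hz', hx, hy'⟩)
    · rw [(hker _).mpr ((hmemL z).mp hz), (hker _).mpr ((hmemL z').mp hz'), map_zero]
    · obtain ⟨h₁, e₁⟩ := D₁.uniformize_spec _ (fun h ↦ hz ((hmemL z).mpr h))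
      obtain ⟨h₂, e₂⟩ := D₁.uniformize_spec _ (fun h ↦ hz' ((hmemL z').mpr h))
      rw [e₁, e₂, WeierstrassCurve.Affine.Point.map_some]
      simp only [WeierstrassCurve.Affine.Point.some.injEq]
      have eσ : ∀ w : ℂ, (σ : ℂ →ₐ[ℚ] ℂ) w = σ' w := fun w ↦ rfl
      constructor <;>
        simp only [eσ, map_sub, map_div₀, map_mul, map_inv₀, map_pow, map_ofNat, hσb₂, hσa₁, hσa₃, hσc, hwp, hwp',
          ← hx, ← hy']
  -- the two cusps of the statement
  have e1 : (1 / y : ℚ) = ((1 : ℤ) : ℚ) / ((y : ℤ) : ℚ) := by push_cast; rfl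
  have e2 : (1 / (d' * y) : ℚ) = ((1 : ℤ) : ℚ) / ((d' * y : ℤ) : ℚ) := by push_cast; rfl
  rw [e1, e2]
  by_cases hd' : d' = 0
  · -- degenerate level: `dd' ≡ 1 (N)` with `d' = 0` forces `(1 : ZMod N) = 0`, so `Γ₁(N) = SL₂(ℤ)` and both cusp values
    -- are the origin
    have h01 : (0 : ZMod N) = 1 := by rw [← hdd, hd']; push_cast; ring
    haveI : Subsingleton (ZMod N) := subsingleton_of_zero_eq_one h01
    have hall : ∀ g : SL(2, ℤ), g ∈ Gamma1 N := fun g ↦ by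
      rw [Gamma1_mem]
      exact ⟨Subsingleton.elim _ _, Subsingleton.elim _ _, Subsingleton.elim _ _⟩
    set γ : SL(2, ℤ) := ⟨!![1, 0; y, 1], by simp [Matrix.det_fin_two_of]⟩ with hγdef
    have hγ10 : (γ 1 0 : ℤ) ≠ 0 := by simpa [hγdef] using hy
    have hz : modularSymbol D₁.f (((1 : ℤ) : ℚ) / ((y : ℤ) : ℚ)) ∈ L₁.lattice := by
      have := modularSymbol_mem_of_gamma1' D₁ hc γ (hall γ) hγ10
      simpa [hγdef] using this
    have hS10 : ((ModularGroup.S : SL(2, ℤ)) 1 0 : ℤ) ≠ 0 := by simp [ModularGroup.S]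
    have hz' : modularSymbol D₁.f (((1 : ℤ) : ℚ) / ((d' * y : ℤ) : ℚ)) ∈ L₁.lattice := by
      have := modularSymbol_mem_of_gamma1' D₁ hc ModularGroup.S (hall _) hS10
      rw [hd', zero_mul]
      simpa [ModularGroup.S] using this
    exact key (Or.inl ⟨hz, hz'⟩)
  · have hy' : d' * y ≠ 0 := mul_ne_zero hd' hy
    have hyy : ((d' * y : ℤ) : ZMod N) = (d' : ZMod N) * (y : ZMod N) := by push_cast; ring
    exact key (transport_cusp_values D₁ hc σ' hσ' hdd hy hy' hyy)


/-! ## §2 Consequences modulo the remaining named facts (rows of `…NaturalTes75Consumers` with `hSt := naturalTes75_holds`) -/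

omit [NeZero N] in
/-- **Cyclicity of the Shimura kernel ⟸ modularity** (`NaturalTes75.shimuraKernelCyclic_of_modularity_naturalTes75` with T-es-75♮ discharged).
CONDITIONAL on `exists_isNewformOf`. [cite: DiamondShurman2005, Thm. 8.8.3] [cite: Stevens1982, §1.3 Thm. 1.3.1 (b)] -/
theorem shimuraKernelCyclic_of_modularity (hnf : exists_isNewformOf) :
    Summit.BirchSwinnertonDyer.Rank1Residual.ManinAdditive.ShimuraCyclic.ShimuraKernelCyclic :=
  NaturalTes75.shimuraKernelCyclic_of_modularity_naturalTes75 naturalTes75_holds hnf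

omit [NeZero N] in
/-- **Abbes–Ullmo 1996 Thm A and Česnavičius 2018 Thm 1.2 (case `2 ∥ N`), lattice renderings, ⟸ CDT** (`NaturalTes75.abbesUllmo_of_CDT_naturalTes75`,
`NaturalTes75.cesnavicius_of_CDT_naturalTes75` with T-es-75♮ discharged).  CONDITIONAL on `CalegariDimitrovTang2025_unboundedDenominators`.
[cite: CalegariDimitrovTang2025, Thm. 1] [cite: AbbesUllmo1996, Thm. A] [cite: Cesnavicius2018, Thm. 1.2] -/
theorem abbesUllmo_and_cesnavicius_of_CDT (hCDT : CalegariDimitrovTang2025_unboundedDenominators) :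
    abbesUllmo_not_dvd_maninConstant_of_not_dvd_level ∧ cesnavicius_not_two_dvd_maninConstant_of_two_dvd_level :=
  ⟨NaturalTes75.abbesUllmo_of_CDT_naturalTes75 naturalTes75_holds hCDT, NaturalTes75.cesnavicius_of_CDT_naturalTes75 naturalTes75_holds hCDT⟩

end Summit.BirchSwinnertonDyer.BirchSwinnertonDyer.Theorems.ManinLocalTwoThree.StevensGalois

namespace Summit.BirchSwinnertonDyer.BirchSwinnertonDyer.Theorems

open ManinLocalTwoThree

/-- **The conjecture leaf `ManinConstantOne` modulo {modularity, CDT}** (`NaturalTes75.maninConstantOne_of_modularity_CDT_naturalTes75` with T-es-75♮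
discharged by `StevensGalois.naturalTes75_holds`).  CONDITIONAL on the two named facts; Manin's conjecture is NOT proved unconditionally; BSD is not
proved. [cite: CalegariDimitrovTang2025, Thm. 1] [cite: DiamondShurman2005, Thm. 8.8.3] -/
theorem maninLocalTwoThree_maninConstantOne_of_CDT_of_modularity (hCDT : CalegariDimitrovTang2025_unboundedDenominators)
    (hnf : exists_isNewformOf) : Summit.BirchSwinnertonDyer.Rank1Residual.ManinConstant.ManinConstantOne :=
  NaturalTes75.maninConstantOne_of_modularity_CDT_naturalTes75 StevensGalois.naturalTes75_holds hnf hCDT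

/-- **The route's rung target `ManinConstantOneRung` (stmt-BirchSwinnertonDyer-22445) BY NAME modulo {modularity, CDT}**
(`NaturalTes75.maninLocalTwoThree_maninConstantOneRung_of_modularity_CDT_naturalTes75` with T-es-75♮ discharged).  CONDITIONAL on the two named
facts; the item stays OPEN as filed; BSD is not proved. [cite: CalegariDimitrovTang2025, Thm. 1] [cite: DiamondShurman2005, Thm. 8.8.3] -/
theorem maninLocalTwoThree_maninConstantOneRung_of_CDT_of_modularity (hCDT : CalegariDimitrovTang2025_unboundedDenominators)
    (hnf : exists_isNewformOf) : Summit.BirchSwinnertonDyer.BirchSwinnertonDyer.Theses.ManinLocalTwoThree.ManinConstantOneRung :=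
  NaturalTes75.maninLocalTwoThree_maninConstantOneRung_of_modularity_CDT_naturalTes75 StevensGalois.naturalTes75_holds hnf hCDT

end Summit.BirchSwinnertonDyer.BirchSwinnertonDyer.Theorems

end
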